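import Summits.QuantumFields.BalabanUV.T4Continuum.Support.NE9Lemma1CurveSpecies
import Summits.QuantumFields.BalabanUV.T4Continuum.Support.NE9Lemma1RemainderSpeciesEnd

/-!
# NE9Lemma1CurveSpeciesEnd — LOCATED CORRECTION O-ne9p1g25-1, part 3 of 3: the NE9 frame's END (marginal-projection face
# `…_compProj`) AT THE CURVE SPECIES — the channel binders S3-sum / S5 DISCHARGED BY NAME from `NE9Lemma1PieceClass` +
# `NE9Lemma1CurveSpecies`, S3-additivity from the displayed `PieceAdditiveOn` (crew row (w19)), everything else displayed as in
# the face; gen 24's `termSize_ne9_and_fadingMemory_rem_compProj` is this theorem at the ray sub-case (`RemData.toCur_toC`)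
# (cell `pub-balaban`, T4-DAG §2 node U3 / §6 NE9; lineage t4-ne9-p1 = row NE9 OWNER, generation 25)

v1.0.1 DOCFIX (docstrings only): curve parametrisation written σ ↦ U_j(□₀, exp iσB)|_X (centred at 0; v1 wrote «exp i(τ + σ)B»).

HONEST FRAMING (T4-DAG PAGE 1).  Rung (B)+1 of the FINITE-VOLUME T⁴ programme — NOT infinite volume, NOT a mass gap, NOT the
Clay problem.  NE9 (`T4OutputRate.NE9` ∧ `FadingMemory`) is a cell NEW ESTIMATE, NOT PRINTED, NOT discharged here; spine 0/9.
HONEST DEPENDENCY (cell line, verbatim): continuum YM on T⁴ ⇐ BetaPertH ∧ nine spine estimates (0/9 proved); BetaPertH ⇐ (D1)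
∧ (D4) ∧ CAP+tail; G-an2-4 gates asym, D1 and NE2/3/4.  `FlowStep.BetaPertH`, (B), (B^μ) do not occur.  [I] = [Balaban1987RG1]
(CMP **109**), [II] = [Balaban1988RG2Cluster] (CMP **116**) are quoted for TYPES only (ABSOLUTE RULE: nothing printed in the
audited series is asserted).

WHAT THIS FILE IS.  Gen 24's part 3 (`NE9Lemma1RemainderSpeciesEnd`) fed the skeleton's END on the corrected dictionary `T := 𝒯 ∘ P`
(`NE9MarginalProjectionEnd.ne9_and_fadingMemory_of_couplingTwoPoint_vacSub_sizeInduction_compProj`) with the S-binders of the RAY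
species.  By the located correction O-ne9p1g25-1 (parts 1–2: [I] (3.34)/(3.54) take the remainder along the analytic CURVE
σ ↦ U_j(□₀, exp iσB)|_X of Lemma 4 (3.53) — nonlinear in σ for non-abelian G, (3.37) p. 277 / (3.30) p. 276) the species
Bałaban's pieces can instantiate is the CURVE species `NE9Lemma1CurveSpecies.CurData`; THIS FILE is the same END face at that
species: **`termSize_ne9_and_fadingMemory_cur_compProj`** with `hsum` := `channelStepSum_cpiece`, `hstep` := `channelSizeAtStepNN_cur`
restricted to `MF ⊆ analyticClass D.R` (gen 24's `channelSizeAtStepNN_mono` BY NAME), `hτ` := `NE9Lemma1Gain.profileG` (τ̄ = c_Q),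
`hadd` from the DISPLAYED `PieceAdditiveOn (analyticClass D.R) D.toC` (crew row (w19)); conclusion LITERALLY `TermSize E W κ N ∧
NE9 E W κ (prodModuli ℓ₉ (fun _ => ω′)) ∧ FadingMemory (ℓ₉/ω′) ω′ (…)` with `ω′ = ω + 8·lipbar·B·((1 + c)·c_Q)`.  So on this face
the displayed list for the species is: O1-type data (`CurData` — the slice curves of (k, □₀, Y₀, X; t, s, σ) —, the carriers,
`P`, `Ψ`, `act`, `ρ`, …), `CurData.Admissible` (Lemma 4 TYPE + gain letter + radii + G1), the level counts `LevelCountsG`,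
`PieceAdditiveOn` ((w19)), `MF ⊆ analyticClass`, and the face's own A1/A2/A3/RO-type binders and scalars — NO channel-size or
step-sum binder remains.  DISGUISE TEST: unchanged from the face (skeleton §5 (g2)).

References (TYPES only): [Balaban1987RG1] T. Bałaban, CMP **109** (1987) 249–301, (3.34)–(3.37) p. 277, Lemma 4 (3.53)–(3.54)
p. 280, (0.28)–(0.29) p. 258; [Balaban1988RG2Cluster] T. Bałaban, CMP **116** (1988) 1–22, (1.23)–(1.29) pp. 7–8, (1.33)–(1.36)
p. 9.  Summits-side NEW work (LEAN PLACEMENT RULE); imports part 2 and gen 24's `NE9Lemma1RemainderSpeciesEnd` (for the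
antitonicity lemmas and `NE9MarginalProjectionEnd`) BY NAME; modifies nothing; 0 sorry.  Value = bookkeeping: the corrected
species' S-binders removed from the END's displayed list, NOT summit progress.
-/

noncomputable section

namespace Summit.QuantumFields.BalabanUV.T4Continuum.NE9Lemma1CurveSpeciesEnd

open scoped BigOperators
open Literature.Probability.LatticeModels
open Literature.MathematicalPhysics.QuantumFieldTheory.Balaban1983to89
open Literature.MathematicalPhysics.QuantumFieldTheory.Balaban1983to89.T4OutputRate
open Literature.MathematicalPhysics.QuantumFieldTheory.Balaban1983to89.T4HistoryLipschitzRecursion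
open Literature.MathematicalPhysics.QuantumFieldTheory.Balaban1983to89.T4HistoryLipschitzOuter
open Literature.MathematicalPhysics.QuantumFieldTheory.Balaban1983to89.T4HistoryLipschitzActivity
open Literature.MathematicalPhysics.QuantumFieldTheory.Balaban1983to89.T4HistoryLipschitzActivity (ClusterGeom)
open Literature.MathematicalPhysics.QuantumFieldTheory.Balaban1983to89.T4HistoryLipschitzSegment
open Summit.QuantumFields.BalabanUV.T4Continuum.NE9Lemma1Counting
open Summit.QuantumFields.BalabanUV.T4Continuum.NE9Lemma1Gain
open Summit.QuantumFields.BalabanUV.T4Continuum.NE9Lemma1PieceClass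
open Summit.QuantumFields.BalabanUV.T4Continuum.NE9Lemma1RemainderSpecies
open Summit.QuantumFields.BalabanUV.T4Continuum.NE9Lemma1CurveSpecies
open Summit.QuantumFields.BalabanUV.T4Continuum.NE9Lemma1RemainderSpeciesEnd
open Summit.QuantumFields.BalabanUV.T4Continuum.NE9ComplexEncoding (doubleCarriers)
open Summit.QuantumFields.BalabanUV.T4Continuum.NE9MarginalProjection
open Summit.QuantumFields.BalabanUV.T4Continuum.NE9MarginalProjectionEnd

/-! ## §1 The END face at the curve species -/

section End

variable {C₀ : Carriers} {E : Type} [NormedAddCommGroup E] [NormedSpace ℂ E] {ι α β γ δ : Type} [DecidableEq δ]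

/-- **THE NE9 END (`…_compProj` face) AT THE CURVE SPECIES.**  Carriers `doubleCarriers C₀`, backgrounds in the complex
configuration chart `E`, channel `𝒯 := cpieceChannel D.toC` of `NE9Lemma1CurveSpecies` (the (1.23)-pieces of the fifth-order
remainder ALONG THE SLICE CURVES of [I] Lemma 4 (3.53)), marginal-free class `MF ⊆ analyticClass D.R`.  DISCHARGED BY NAME:
`ChannelStepSum MF 𝒯` (`channelStepSum_cpiece`), `ChannelSizeAtStepNN MF 𝒯 κ wt τ` (`channelSizeAtStepNN_cur` — the per-piece bound
PROVED on the analytic class for curve data — restricted to MF) with `wt := weightOf D.toC.frame κ₁ d₀ O1 (D.Kp c_dir)`,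
`τ k j := c_Q·ω^{k−j}` and its profile (`profileG`, τ̄ = c_Q); `ChannelAdditive MF 𝒯` from the DISPLAYED `PieceAdditiveOn
(analyticClass D.R) D.toC` (crew row (w19), the curve twin of (w16)).  DISPLAYED, as in the face: the projection binders,
factorisation, activity two-point data, channel coupling modulus, representation, KP, geometry, read-out, sizes, scalars; plus the
species' `CurData.Admissible` (Lemma 4 TYPE: the slice curves analytic and inside the analyticity ball on their discs, ϱ > 1, the
gain ϱ⁻¹ ≤ c_dir·ℓ, radii, G1) and `LevelCountsG` ((1.26)–(1.28)).  Conclusion LITERALLY the face's.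
[cite: Balaban1987RG1, (3.53)-(3.54) p.280; Balaban1988RG2Cluster, (1.23)-(1.29) pp.7-8, (1.36) p.9] -/
theorem termSize_ne9_and_fadingMemory_cur_compProj (G : ClusterGeom (doubleCarriers C₀)) {Pot : Type*}
    [NormedAddCommGroup Pot] [NormedSpace ℂ Pot] {D : CurData C₀ E ι α β γ δ} {ℓg : ℕ → ℕ → ℝ} {cdir d0 O1 cQ : ℝ}
    {Ef : Functional (doubleCarriers C₀) E} {W : Set (ℕ → ℝ)}
    {Adm MF : Set (E → (doubleCarriers C₀).Dom → ℝ)}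
    {P : (E → (doubleCarriers C₀).Dom → ℝ) → (E → (doubleCarriers C₀).Dom → ℝ)}
    {Ψ : ℕ → ℝ → (ι → ℝ) → E → (doubleCarriers C₀).Dom → ℝ} {act : ℕ → ℝ → E → Pot → G.P → ℂ} {𝒜 : ℕ → Set Pot}
    {n : ℕ → ℝ → E → G.P → ℝ} {lip clip : ℕ → ℝ} {a d : G.P → ℝ} {δv : (doubleCarriers C₀).Dom → ℝ}
    {κ B lipbar clipbar qTbar ω c : ℝ} {qT p₀ N : ℕ → ℝ}
    -- the species' binders (printed TYPE + numerals) and the class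
    (hD : D.Admissible ℓg cdir d0) (hℓg : ∀ k j, 0 ≤ ℓg k j)
    (hL : LevelCountsG D.toC.frame κ D.κ₁ O1 cQ (fun k j => ℓg k j ^ 5) (agePow ω)) (hO1 : 0 ≤ O1) (hcQ : 0 ≤ cQ)
    (hMF : MF ⊆ analyticClass D.R) (hA : PieceAdditiveOn (analyticClass D.R) D.toC)
    -- the face's binders, verbatim
    (ρ : ℕ → (ι → ℝ) → Pot) (U₀ : E) (explZ : ℕ → E → (doubleCarriers C₀).Dom → ℝ) (h0 : ScaleZeroFree Ef W)
    (hAdm : AdmissibleTerms Ef W Adm) (hres : AdmRestrict Adm)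
    (hPadd : ProjAdditive Adm P) (hPcomm : ProjScaleComm Adm P) (hPinto : ProjInto Adm MF P) (hPsize : ProjSize Adm P κ c)
    (hc : 0 ≤ c)
    (hfac : Factorises Ef W (compProj (cpieceChannel D.toC) P) Ψ) (hclip0 : ∀ k, 0 ≤ clip k)
    (hCup : ∀ g ∈ W, ∀ g' ∈ W, ∀ (k : ℕ) (U : E) (X : (doubleCarriers C₀).Dom), (doubleCarriers C₀).scale X = k + 1 →
      ∀ Q ∈ 𝒜 k, ∀ γ' ∈ G.vol X,
      ‖act k (g k) U Q γ'‖ ≤ n k (g' k) U γ' ∧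
        ‖act k (g k) U Q γ' - act k (g' k) U Q γ'‖ ≤ clip k * |g k - g' k| * n k (g' k) U γ')
    (hqT0 : ∀ k, 0 ≤ qT k)
    (hTcup : ∀ g ∈ W, ∀ g' ∈ W, ∀ (k : ℕ) (y : ι),
      |compProj (cpieceChannel D.toC) P k g (Ef g) y - compProj (cpieceChannel D.toC) P k g' (Ef g) y| ≤
        weightOf D.toC.frame D.κ₁ d0 O1 (D.Kp cdir) k y * (qT k * |g k - g' k|))
    (hreprV : ∀ (k : ℕ) (s : ℝ) (Q : ι → ℝ) (U : E) (X : (doubleCarriers C₀).Dom),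
      Ψ k s Q U X = (G.newTerm act k s U X (ρ k Q)).re - (G.newTerm act k s U₀ X (ρ k Q)).re + explZ k U X)
    (hclipb : ∀ k, clip k ≤ clipbar) (hqTb : ∀ k, qT k ≤ qTbar)
    (hK : TwoPointKP G W act 𝒜 n lip a d) (hdec : G.DecayExtract δv d) (hpin : G.PinBudget a δv (fun _ => B) κ)
    (hρ : ∀ (k : ℕ) (Q Q' : ι → ℝ) (M : ℝ),
      (∀ y, |Q y - Q' y| ≤ weightOf D.toC.frame D.κ₁ d0 O1 (D.Kp cdir) k y * M) → ‖ρ k Q - ρ k Q'‖ ≤ M)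
    (hexplZ : ∀ (k : ℕ) (U : E) (X : (doubleCarriers C₀).Dom), (doubleCarriers C₀).scale X = k + 1 →
      |explZ k U X| ≤ Real.exp (-(κ * (doubleCarriers C₀).d X)) * p₀ k)
    (hbase : ∀ g ∈ W, ∀ (U : E) (X : (doubleCarriers C₀).Dom), (doubleCarriers C₀).scale X = 0 →
      |Ef g U X| ≤ Real.exp (-(κ * (doubleCarriers C₀).d X)) * N 0)
    (hNsucc : ∀ j, p₀ j + 2 * B ≤ N (j + 1)) (hNnn : ∀ j, 0 ≤ N j)
    (hbox : ∀ (k : ℕ) (Q : ι → ℝ), (∀ y, |Q y| ≤ weightOf D.toC.frame D.κ₁ d0 O1 (D.Kp cdir) k y *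
      sizeRadius (fun k j => (1 + c) * tauOfG cQ (agePow ω) k j) N k) → ρ k Q ∈ 𝒜 k)
    (hB : 0 ≤ B) (hlipb : ∀ k, lip k ≤ lipbar) (hω : 0 ≤ ω)
    (hpos : 0 < ω + 8 * lipbar * B * ((1 + c) * cQ)) :
    TermSize Ef W κ N ∧
      NE9 Ef W κ (prodModuli (8 * clipbar * B + 8 * lipbar * B * qTbar)
        fun _ => ω + 8 * lipbar * B * ((1 + c) * cQ)) ∧
        FadingMemory ((8 * clipbar * B + 8 * lipbar * B * qTbar) / (ω + 8 * lipbar * B * ((1 + c) * cQ)))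
          (ω + 8 * lipbar * B * ((1 + c) * cQ))
          (prodModuli (8 * clipbar * B + 8 * lipbar * B * qTbar) fun _ => ω + 8 * lipbar * B * ((1 + c) * cQ)) := by
  -- the species' S-binders on MF, by name
  have hsum : ChannelStepSum MF (cpieceChannel D.toC) :=
    channelStepSum_cpiece (pieceZero_cur D) (pieceLocal_cur D) (csrcScale_cur hD) MF
  have hstep : ChannelSizeAtStepNN MF (cpieceChannel D.toC) κ (weightOf D.toC.frame D.κ₁ d0 O1 (D.Kp cdir))
      (tauOfG cQ (agePow ω)) :=
    channelSizeAtStepNN_mono hMF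
      (channelSizeAtStepNN_cur hD hℓg κ hL hO1 (fun k j => mul_nonneg hcQ (agePow_nonneg hω k j)))
  have hadd : ChannelAdditive MF (cpieceChannel D.toC) := channelAdditive_cpiece (pieceAdditiveOn_mono hMF hA)
  have hprof := profileG hcQ hω (ω := ω)
  have hτ : ∀ k j, j ≤ k → 0 ≤ tauOfG cQ (agePow ω) k j ∧ tauOfG cQ (agePow ω) k j ≤ cQ * ω ^ (k - j) :=
    fun k j hjk => ⟨mul_nonneg hcQ (agePow_nonneg hω k j), hprof.1 k j hjk⟩
  exact ne9_and_fadingMemory_of_couplingTwoPoint_vacSub_sizeInduction_compProj G ρ U₀ explZ h0 hAdm hres hPadd hPcomm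
    hPinto hPsize hc hadd hsum hstep hfac hclip0 hCup hqT0 hTcup hreprV hclipb hqTb hK hdec hpin hρ hexplZ hbase hNsucc hNnn
    hbox hB hlipb hcQ hω hpos hτ

end End

/-! ## §2 Gen 24's ray END is the curve END at the ray reading (consistency, by name) -/

section RayCase

variable {C₀ : Carriers} {E : Type} [NormedAddCommGroup E] [NormedSpace ℂ E] {ι α β γ δ : Type} [DecidableEq δ]

/-- The ray species' END face hypotheses produce the curve species' END face conclusion at the ray reading `D.toCur`
(`RemData.toCur_toC : D.toCur.toC = D.toC` is `rfl`, so the two faces have literally the same channel); recorded as the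
one-line transport of the S5 binder, the only species-specific input. [folklore] -/
example {D : RemData C₀ E ι α β γ δ} {ℓg ℓ' : ℕ → ℕ → ℝ} {cdir d0 O1 cQ : ℝ}
    (hD : D.Admissible ℓg cdir d0) (hpos : ∀ k s y a b x, 0 < D.dirB k s y a b x) (hℓg : ∀ k j, 0 ≤ ℓg k j) (κ : ℝ)
    (hL : LevelCountsG D.toC.frame κ D.κ₁ O1 cQ (fun k j => ℓg k j ^ 5) ℓ') (hO1 : 0 ≤ O1)
    (hcQℓ : ∀ k j, 0 ≤ cQ * ℓ' k j) :
    ChannelSizeAtStepNN (analyticClass D.R) (cpieceChannel D.toC) κ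
      (weightOf D.toC.frame D.κ₁ d0 O1 (D.toCur.Kp cdir)) (tauOfG cQ ℓ') := by
  rw [← D.toCur_toC]
  exact channelSizeAtStepNN_cur (hD.toCur hpos) hℓg κ hL hO1 hcQℓ

end RayCase

end Summit.QuantumFields.BalabanUV.T4Continuum.NE9Lemma1CurveSpeciesEnd
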